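import Summits.QuantumAdvantage.QuantumAdvantage.Theorems.CubicForrelationNearExactIsExactTwelveOddWeightR4Cells

/-!
# Crux `CubicForrelation.NearExactIsExact` (stmt-QuantumAdvantage-14043) — n = 12, WEIGHT OF A TYPE-O CUBIC, VIa: the five forms of case R4

Certificate seat `b2b-cforr-cert` (gen 32).  HONEST FRAMING: a bookkeeping lemma (standard axioms) for …TwelveOddWeightR4; NOT summit progress.

`tow_R4_forms`: for a quadratic `q` with period `a ≠ 0` and a symplectic frame `a₀,…,a₃` (`B(a₀,a₁) = B(a₂,a₃) = 1`, crosses `0`), the four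
affine derivatives `D_{a₁}q, D_{a₀}q, D_{a₃}q, D_{a₂}q` are shifted parities `bⱼ ⊕ ⟨x,cⱼ⟩`, and together with a fifth form `y₅` (`⟨a,y₅⟩ = 1`,
orthogonalised against the frame) the forms `c₀,…,c₃,y₅` are Kronecker-dual to `a₀,…,a₃,a`.

References: L. E. Dickson (1901); F. J. MacWilliams, N. J. A. Sloane (1977) Ch. 15.  Axioms: the standard three.
-/

set_option linter.dupNamespace false -- D-0017: single-problem summit ⇒ `QuantumAdvantage.QuantumAdvantage` by design

noncomputable section

namespace Summit.QuantumAdvantage.QuantumAdvantage.Theorems.CubicForrelation.NearExactIsExact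

open Finset
open Literature.Computability.QuantumComplexity
open Literature.Computability.QuantumComplexity.BuzetChailloux (bxor zeroVec bxor_bxor_cancel_left bxor_zeroVec zeroVec_bxor bxor_comm
  bxor_self twist_bxor_right twist_zeroVec_right sum_twist_left bxor_eq_zeroVec_iff)
open Literature.Computability.QuantumComplexity.DerivativeWalsh (W twist_bxor_left)

/-- `∀ i : Fin 5` as a conjunction. [folklore] -/
private theorem tow_forall_fin5 (P : Fin 5 → Prop) : (∀ i, P i) ↔ P 0 ∧ P 1 ∧ P 2 ∧ P 3 ∧ P 4 := by
  constructor
  · intro h; exact ⟨h 0, h 1, h 2, h 3, h 4⟩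
  · rintro ⟨h0, h1, h2, h3, h4⟩ i
    fin_cases i
    · exact h0
    · exact h1
    · exact h2
    · exact h3
    · exact h4

/-- Parity against the zero vector vanishes. [folklore] -/
theorem tow_parity_zeroVec {n : ℕ} (c : Fin n → Bool) : decide (Odd #(univ.filter fun j => (zeroVec : Fin n → Bool) j && c j)) = false := by
  simp [zeroVec]

/-- `B(a, z) = 0` when `a` is a period of the quadratic `q`. [folklore] -/
theorem tow_B_period {n : ℕ} (q : (Fin n → Bool) → Bool) (a z : Fin n → Bool) (hper : ∀ x, q (bxor x a) = q x) :
    (q zeroVec ^^ q a ^^ q z ^^ q (bxor a z)) = false := by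
  rw [bxor_comm a z, hper z, ← zeroVec_bxor a, hper zeroVec]
  cases q zeroVec <;> cases q z <;> rfl

/-- **The five forms of case R4.**  For a quadratic `q` with period `a ≠ 0` and a symplectic frame `a₀,…,a₃`, the four affine derivatives are
shifted parities `bⱼ ⊕ ⟨x,cⱼ⟩` and, with a fifth form `y₅` (`⟨a,y₅⟩ = 1`), the forms `c₀,…,c₃,y₅` are Kronecker-dual to `a₀,…,a₃,a`.
Bookkeeping, NOT summit progress. [this work] -/
theorem tow_R4_forms (q : (Fin (6 + 6) → Bool) → Bool) (hq2 : IsDegLeFun 2 q) (a : Fin (6 + 6) → Bool) (ha : a ≠ zeroVec)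
    (hqa : ∀ x, q (bxor x a) = q x) (a₀ a₁ a₂ a₃ : Fin (6 + 6) → Bool)
    (h01 : (q zeroVec ^^ q a₀ ^^ q a₁ ^^ q (bxor a₀ a₁)) = true) (h23 : (q zeroVec ^^ q a₂ ^^ q a₃ ^^ q (bxor a₂ a₃)) = true)
    (h02 : (q zeroVec ^^ q a₀ ^^ q a₂ ^^ q (bxor a₀ a₂)) = false) (h03 : (q zeroVec ^^ q a₀ ^^ q a₃ ^^ q (bxor a₀ a₃)) = false)
    (h12 : (q zeroVec ^^ q a₁ ^^ q a₂ ^^ q (bxor a₁ a₂)) = false) (h13 : (q zeroVec ^^ q a₁ ^^ q a₃ ^^ q (bxor a₁ a₃)) = false) :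
    ∃ (c₀ c₁ c₂ c₃ y₅ : Fin (6 + 6) → Bool) (b₀ b₁ b₂ b₃ : Bool),
      (∀ x, (q x ^^ q (bxor x a₁)) = (b₀ ^^ decide (Odd #(univ.filter fun j => x j && c₀ j)))) ∧
      (∀ x, (q x ^^ q (bxor x a₀)) = (b₁ ^^ decide (Odd #(univ.filter fun j => x j && c₁ j)))) ∧
      (∀ x, (q x ^^ q (bxor x a₃)) = (b₂ ^^ decide (Odd #(univ.filter fun j => x j && c₂ j)))) ∧
      (∀ x, (q x ^^ q (bxor x a₂)) = (b₃ ^^ decide (Odd #(univ.filter fun j => x j && c₃ j)))) ∧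
      decide (Odd #(univ.filter fun j => a j && y₅ j)) = true ∧
      ∀ i j : Fin 5, decide (Odd #(univ.filter fun l => (![a₀, a₁, a₂, a₃, a] : Fin 5 → Fin (6 + 6) → Bool) j l &&
        (![c₀, c₁, c₂, c₃, y₅] : Fin 5 → Fin (6 + 6) → Bool) i l)) = decide (i = j) := by
  classical
  have hsymm := es_B_symm q
  have h10 : (q zeroVec ^^ q a₁ ^^ q a₀ ^^ q (bxor a₁ a₀)) = true := by rw [hsymm]; exact h01
  have h32 : (q zeroVec ^^ q a₃ ^^ q a₂ ^^ q (bxor a₃ a₂)) = true := by rw [hsymm]; exact h23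
  have h20 : (q zeroVec ^^ q a₂ ^^ q a₀ ^^ q (bxor a₂ a₀)) = false := by rw [hsymm]; exact h02
  have h30 : (q zeroVec ^^ q a₃ ^^ q a₀ ^^ q (bxor a₃ a₀)) = false := by rw [hsymm]; exact h03
  have h21 : (q zeroVec ^^ q a₂ ^^ q a₁ ^^ q (bxor a₂ a₁)) = false := by rw [hsymm]; exact h12
  have h31 : (q zeroVec ^^ q a₃ ^^ q a₁ ^^ q (bxor a₃ a₁)) = false := by rw [hsymm]; exact h13
  have h00 := es_B_self q a₀; have h11 := es_B_self q a₁; have h22 := es_B_self q a₂; have h33 := es_B_self q a₃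
  have hBa : ∀ z, (q zeroVec ^^ q a ^^ q z ^^ q (bxor a z)) = false := fun z => tow_B_period q a z hqa
  -- the four affine derivatives as shifted parities: `φ_j x = b_j ⊕ ⟨x, c_j⟩`
  obtain ⟨c₀, b₀, hc₀⟩ := tow_affine_bits (fun x => q x ^^ q (bxor x a₁)) (stub_derivDegree (6 + 6) 1 q a₁ hq2)
  obtain ⟨c₁, b₁, hc₁⟩ := tow_affine_bits (fun x => q x ^^ q (bxor x a₀)) (stub_derivDegree (6 + 6) 1 q a₀ hq2)
  obtain ⟨c₂, b₂, hc₂⟩ := tow_affine_bits (fun x => q x ^^ q (bxor x a₃)) (stub_derivDegree (6 + 6) 1 q a₃ hq2)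
  obtain ⟨c₃, b₃, hc₃⟩ := tow_affine_bits (fun x => q x ^^ q (bxor x a₂)) (stub_derivDegree (6 + 6) 1 q a₂ hq2)
  -- parities of the forms: `⟨t, c_j⟩ = B(t, partner)`
  have hpar : ∀ (c : Fin (6 + 6) → Bool) (b : Bool) (a' : Fin (6 + 6) → Bool),
      (∀ x, (q x ^^ q (bxor x a')) = (b ^^ decide (Odd #(univ.filter fun j => x j && c j)))) →
      ∀ t, decide (Odd #(univ.filter fun j => t j && c j)) = (q zeroVec ^^ q t ^^ q a' ^^ q (bxor t a')) := by
    intro c b a' h t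
    have h0 := h zeroVec
    rw [zeroVec_bxor, tow_parity_zeroVec, Bool.xor_false] at h0
    have ht := h t
    rw [← h0] at ht
    revert ht
    cases q zeroVec <;> cases q t <;> cases q a' <;> cases q (bxor t a') <;> cases decide (Odd #(univ.filter fun j => t j && c j)) <;> simp
  have hP₀ := hpar c₀ b₀ a₁ hc₀
  have hP₁ := hpar c₁ b₁ a₀ hc₁
  have hP₂ := hpar c₂ b₂ a₃ hc₂
  have hP₃ := hpar c₃ b₃ a₂ hc₃
  -- the fifth form, orthogonalised against the frame
  obtain ⟨y, hy⟩ := es_exists_twist_neg ha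
  have hay : decide (Odd #(univ.filter fun j => a j && y j)) = true := by
    rw [vg_twist_eq_signOf] at hy
    revert hy; cases decide (Odd #(univ.filter fun j => a j && y j)) <;> norm_num [signOf]
  set β₀ := decide (Odd #(univ.filter fun j => a₀ j && y j)) with hβ₀
  set β₁ := decide (Odd #(univ.filter fun j => a₁ j && y j)) with hβ₁
  set β₂ := decide (Odd #(univ.filter fun j => a₂ j && y j)) with hβ₂
  set β₃ := decide (Odd #(univ.filter fun j => a₃ j && y j)) with hβ₃
  set y₅ : Fin (6 + 6) → Bool := fun j => y j ^^ ((β₀ && c₀ j) ^^ (β₁ && c₁ j) ^^ (β₂ && c₂ j) ^^ (β₃ && c₃ j)) with hy₅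
  have hy₅par : ∀ t, decide (Odd #(univ.filter fun j => t j && y₅ j)) =
      (decide (Odd #(univ.filter fun j => t j && y j)) ^^ ((β₀ && (q zeroVec ^^ q t ^^ q a₁ ^^ q (bxor t a₁))) ^^
        (β₁ && (q zeroVec ^^ q t ^^ q a₀ ^^ q (bxor t a₀))) ^^ (β₂ && (q zeroVec ^^ q t ^^ q a₃ ^^ q (bxor t a₃))) ^^
        (β₃ && (q zeroVec ^^ q t ^^ q a₂ ^^ q (bxor t a₂))))) := by
    intro t
    have e : y₅ = bxor y (fun j => (β₀ && c₀ j) ^^ (β₁ && c₁ j) ^^ (β₂ && c₂ j) ^^ (β₃ && c₃ j)) := rfl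
    have hm := tow_mask_parity t c₀ c₁ c₂ c₃ false false false false β₀ β₁ β₂ β₃
    simp only [Bool.false_xor, Bool.and_false, Bool.xor_false] at hm
    rw [e, tow_parity_bxor_right, ← hm, hP₀ t, hP₁ t, hP₂ t, hP₃ t]
  have hay₅ : decide (Odd #(univ.filter fun j => a j && y₅ j)) = true := by
    rw [hy₅par a, hay, hBa a₁, hBa a₀, hBa a₃, hBa a₂]; cases β₀ <;> cases β₁ <;> cases β₂ <;> cases β₃ <;> rfl
  have ha₀y₅ : decide (Odd #(univ.filter fun j => a₀ j && y₅ j)) = false := by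
    rw [hy₅par a₀, ← hβ₀, h01, h00, h03, h02]; cases β₀ <;> cases β₁ <;> cases β₂ <;> cases β₃ <;> rfl
  have ha₁y₅ : decide (Odd #(univ.filter fun j => a₁ j && y₅ j)) = false := by
    rw [hy₅par a₁, ← hβ₁, h11, h10, h13, h12]; cases β₀ <;> cases β₁ <;> cases β₂ <;> cases β₃ <;> rfl
  have ha₂y₅ : decide (Odd #(univ.filter fun j => a₂ j && y₅ j)) = false := by
    rw [hy₅par a₂, ← hβ₂, h21, h20, h23, h22]; cases β₀ <;> cases β₁ <;> cases β₂ <;> cases β₃ <;> rfl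
  have ha₃y₅ : decide (Odd #(univ.filter fun j => a₃ j && y₅ j)) = false := by
    rw [hy₅par a₃, ← hβ₃, h31, h30, h33, h32]; cases β₀ <;> cases β₁ <;> cases β₂ <;> cases β₃ <;> rfl
  -- the dual system and the `128`-point cells
  have hdual : ∀ i j : Fin 5, decide (Odd #(univ.filter fun l => (![a₀, a₁, a₂, a₃, a] : Fin 5 → Fin (6 + 6) → Bool) j l &&
      (![c₀, c₁, c₂, c₃, y₅] : Fin 5 → Fin (6 + 6) → Bool) i l)) = decide (i = j) := by
    have ez0 : (![c₀, c₁, c₂, c₃, y₅] : Fin 5 → Fin (6 + 6) → Bool) 0 = c₀ := rfl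
    have ez1 : (![c₀, c₁, c₂, c₃, y₅] : Fin 5 → Fin (6 + 6) → Bool) 1 = c₁ := rfl
    have ez2 : (![c₀, c₁, c₂, c₃, y₅] : Fin 5 → Fin (6 + 6) → Bool) 2 = c₂ := rfl
    have ez3 : (![c₀, c₁, c₂, c₃, y₅] : Fin 5 → Fin (6 + 6) → Bool) 3 = c₃ := rfl
    have ez4 : (![c₀, c₁, c₂, c₃, y₅] : Fin 5 → Fin (6 + 6) → Bool) 4 = y₅ := rfl
    have ea0 : (![a₀, a₁, a₂, a₃, a] : Fin 5 → Fin (6 + 6) → Bool) 0 = a₀ := rfl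
    have ea1 : (![a₀, a₁, a₂, a₃, a] : Fin 5 → Fin (6 + 6) → Bool) 1 = a₁ := rfl
    have ea2 : (![a₀, a₁, a₂, a₃, a] : Fin 5 → Fin (6 + 6) → Bool) 2 = a₂ := rfl
    have ea3 : (![a₀, a₁, a₂, a₃, a] : Fin 5 → Fin (6 + 6) → Bool) 3 = a₃ := rfl
    have ea4 : (![a₀, a₁, a₂, a₃, a] : Fin 5 → Fin (6 + 6) → Bool) 4 = a := rfl
    rw [tow_forall_fin5]
    refine ⟨?_, ?_, ?_, ?_, ?_⟩ <;> rw [tow_forall_fin5] <;> refine ⟨?_, ?_, ?_, ?_, ?_⟩ <;>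
      simp only [ez0, ez1, ez2, ez3, ez4, ea0, ea1, ea2, ea3, ea4, hP₀, hP₁, hP₂, hP₃, hay₅, ha₀y₅, ha₁y₅, ha₂y₅, ha₃y₅, hBa, h10, h00, h30, h20,
        h01, h11, h31, h21, h12, h02, h32, h22, h13, h03, h33, h23] <;> decide
  exact ⟨c₀, c₁, c₂, c₃, y₅, b₀, b₁, b₂, b₃, hc₀, hc₁, hc₂, hc₃, hay₅, hdual⟩

end Summit.QuantumAdvantage.QuantumAdvantage.Theorems.CubicForrelation.NearExactIsExact

end
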